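import Summits.NavierStokesRegularity.FluidComputer.ClayBlowupVorticityBudget
import HarnessLib

/-!
# COHERENT WINDOWS ARE ENSTROPHY-NEUTRAL UP TO A FIXED FACTOR: the quantitative Constantin–Fefferman
# bound between two times, WITH the Clay force, for every Clay blow-up and every tower realisation

Cell `ns-blowup`, seat `ns-blowup-ecbridge-2` (g9; the E–C endpoint theory seat). LABEL: E–C typing
(KERNEL — no named fact). WHAT THIS IS NOT: not Navier–Stokes evidence — a-priori bookkeeping on the
TYPES `ClayBlowup ν` / `Realisation ν R` (no inhabitant is claimed anywhere). Companion memo: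
`run/shared/lean/pub/ns-blowup/ecbridge2/ECBRIDGE-2-MEMO-8.md`.

## Content

`ClayBlowupForcedVorticityCriteria` records the QUALITATIVE Constantin–Fefferman row (direction
incoherence somewhere before `T`) with the Clay force. The Literature bound behind it
(`sq_norm_curl_le_of_direction_slab_forced`, with the purely spatial stretching estimate
`exists_two_mul_integral_stretching_le`) is quantitative; applied to the blow-up shifted to a window
`[t₀, t₁] ⊂ [0, T)` on which the vorticity directions ARE coherent — `√(1 − ⟪ξ(t,x), ξ(t,y)⟫²) ≤ |x−y|/ρ`
whenever `|ω(t,x)|, |ω(t,y)| > Ω`, `t ∈ [t₀, t₁]` — and fed the type's ONE energy/dissipation bound,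
it yields TWO constants `P, Q ≥ 0` depending only on the blow-up, `ν`, `Ω` and `ρ` with

  `∫|ω(t₁)|² ≤ (∫|ω(t₀)|² + P) · Q`   for EVERY coherent window `[t₀, t₁]`

(`ClayBlowup.sq_norm_curl_le_of_coherent_window`): over a window of direction coherence the vorticity
`L²` mass grows by at most a fixed affine factor — all the enstrophy growth of a blow-up beyond that
factor is carried by windows of direction INCOHERENCE at scale `ρ` above the threshold `Ω`. The tower
reading (`Realisation.sq_norm_curl_le_of_coherent_readout_window`): between two readouts over which the
design keeps its vorticity directions `ρ`-Lipschitz on `{|ω| > Ω}`, the enstrophy e-folds are bounded by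
`log Q + log(1 + P/∫|ω(τ_j)|²)`, independently of the levels grown in between.

References: P. Constantin, C. Fefferman (1993), §2 [cite: ConstantinFeffermanIndiana1993, §2 (the enstrophy bound)];
P. G. Lemarié-Rieusset (2016), Thm. 11.7 [cite: LemarieRieusset2016, Thm. 11.7 (proof)]; T. Tao (2013),
Lemma 8.1 [cite: Tao2011, Lemma 8.1]; S. Palasek, arXiv:2605.13827 §4 [cite: Palasek2026ElementaryModel, §4].
-/

noncomputable section

namespace Summit.NavierStokesRegularity.FluidComputer

open Set MeasureTheory Filter Topology Function Metric
open scoped ENNReal ContDiff NNReal RealInnerProductSpace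
open Literature.Analysis.FluidPDE
open Summit.NavierStokesRegularity.NavierStokesRegularity
open Summit.NavierStokesRegularity.FluidComputer.PalasekTowerClayBridge

namespace ClayBlowup

variable {ν : ℝ} (X : ClayBlowup ν)

set_option maxHeartbeats 800000 in
/-- **COHERENT WINDOWS ARE ENSTROPHY-NEUTRAL UP TO A FIXED FACTOR** (the quantitative Constantin–Fefferman
bound between two times, WITH the Clay force; `ν > 0`, `Ω > 0`, `ρ > 0`; no named fact): there are
`P, Q ≥ 0` (depending on the blow-up, `ν`, `Ω`, `ρ` only) such that for all `0 ≤ t₀ < t₁ < T`, if the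
vorticity directions satisfy `√(1 − ⟪ξ(t,x), ξ(t,y)⟫²) ≤ |x − y|/ρ` whenever `|ω(t, x)|, |ω(t, y)| > Ω`
for every `t ∈ [t₀, t₁]`, then `∫|curl u(t₁)|² ≤ (∫|curl u(t₀)|² + P) · Q`. With the constants
`C₁, …, C₄` of `exists_two_mul_integral_stretching_le`, `Ē`, `I` the energy and dissipation bounds of the
type and `G` the `L²` bound of `curl f`: `P = C₄ I + G T`, `Q = exp((C₁ + C₃Ē + 1)T + C₂‖curl‖² I)`.
[cite: ConstantinFeffermanIndiana1993, §2 (the enstrophy bound)] [cite: Tao2011, Lemma 8.1] -/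
theorem sq_norm_curl_le_of_coherent_window (hν : 0 < ν) {Ω ρ : ℝ} (hΩ : 0 < Ω) (hρ : 0 < ρ) :
    ∃ P Q : ℝ, 0 ≤ P ∧ 0 ≤ Q ∧ ∀ t₀ t₁ : ℝ, 0 ≤ t₀ → t₀ < t₁ → t₁ < X.T →
      (∀ t ∈ Icc t₀ t₁, ∀ x y : EuclideanSpace ℝ (Fin 3),
        Ω < ‖curl (X.u t) x‖ → Ω < ‖curl (X.u t) y‖ →
          Real.sqrt (1 - inner ℝ (vorticityDirection (curl (X.u t)) x)
            (vorticityDirection (curl (X.u t)) y) ^ 2) ≤ ‖x - y‖ / ρ) →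
      ∫ x, ‖curl (X.u t₁) x‖ ^ 2 ≤ ((∫ x, ‖curl (X.u t₀) x‖ ^ 2) + P) * Q := by
  have hT := X.T_pos
  obtain ⟨G, hG⟩ := X.exists_lintegral_curl_force_sq_le
  obtain ⟨C₁, C₂, C₃, C₄, hC₁, hC₂, hC₃, hC₄, hstr⟩ := exists_two_mul_integral_stretching_le hν hΩ hρ
  obtain ⟨E, hEt, hEn, hdis⟩ := X.energy_dissipation_le hν
  have hν' : ENNReal.ofReal ν ≠ 0 := (ENNReal.ofReal_pos.2 hν).ne'
  set Ē : ℝ := E.toReal with hĒ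
  have hĒ0 : 0 ≤ Ē := ENNReal.toReal_nonneg
  set I : ℝ := (E / ENNReal.ofReal ν).toReal with hIdef
  have hI0 : 0 ≤ I := ENNReal.toReal_nonneg
  have hdissT : ∫⁻ t in Ioo 0 X.T, ∫⁻ x, ENNReal.ofReal (frobeniusNormSq (fderiv ℝ (X.u t) x)) ≤
      ENNReal.ofReal I := by
    have h1 : ∫⁻ t in Ioo 0 X.T, ∫⁻ x, ENNReal.ofReal (frobeniusNormSq (fderiv ℝ (X.u t) x)) ≤
        E / ENNReal.ofReal ν := by
      rw [ENNReal.le_div_iff_mul_le (Or.inl hν') (Or.inl ENNReal.ofReal_ne_top), mul_comm]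
      exact hdis
    refine h1.trans (le_of_eq ?_)
    rw [hIdef, ENNReal.ofReal_toReal]
    exact (ENNReal.div_lt_top hEt.ne hν').ne
  set P : ℝ := C₄ * I + G * X.T with hP
  set Q : ℝ := Real.exp ((C₁ + C₃ * Ē + 1) * X.T + C₂ * (‖curlCLM‖ ^ 2 * I)) with hQ
  refine ⟨P, Q, by positivity, (Real.exp_pos _).le, ?_⟩
  intro t₀ t₁ h0 h01 h1T hdir
  have hD : 0 < t₁ - t₀ := by linarith
  have ht1 : 0 < t₁ := lt_of_le_of_lt h0 h01
  -- the blow-up shifted to `[t₀, t₁]`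
  have hsubI : ∀ τ ∈ Icc 0 (t₁ - t₀), τ + t₀ ∈ Icc 0 t₁ := fun τ hτ =>
    ⟨by linarith [hτ.1], by linarith [hτ.2]⟩
  have hS : IsClassicalNSSolutionOn (Icc 0 (t₁ - t₀)) ν (fun τ => X.f (τ + t₀))
      (fun τ => X.u (τ + t₀)) (fun τ => X.p (τ + t₀)) :=
    ((X.classical_Icc ht1 h1T).comp_add_right t₀).mono (fun τ hτ => hsubI τ hτ) (uniqueDiffOn_Icc hD)
  have hB : HasBoundedSobolevNormsOn (Icc 0 (t₁ - t₀)) (fun τ => X.u (τ + t₀)) := fun n =>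
    ((X.hasBoundedSobolevNormsOn hν ht1 h1T) n).imp fun _ hC t ht => hC (t + t₀) (hsubI t ht)
  have hGs : ∀ t ∈ Icc 0 (t₁ - t₀), ∫⁻ x, ‖curl ((fun τ => X.f (τ + t₀)) t) x‖ₑ ^ 2 ≤ G :=
    fun t ht => hG (t + t₀) (by linarith [ht.1])
  have hen' : ∀ t ∈ Icc 0 (t₁ - t₀), ∫⁻ x, ‖(fun τ => X.u (τ + t₀)) t x‖ₑ ^ 2 ≤ ENNReal.ofReal Ē :=
    fun t ht => by
      rw [hĒ, ENNReal.ofReal_toReal hEt.ne]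
      exact hEn (t + t₀) ⟨by linarith [ht.1], by linarith [ht.2]⟩
  have hdiss' : ∫⁻ τ in Ioo 0 (t₁ - t₀), ∫⁻ x,
      ENNReal.ofReal (frobeniusNormSq (fderiv ℝ ((fun τ => X.u (τ + t₀)) τ) x)) ≤ ENNReal.ofReal I := by
    have htr := setLIntegral_Ioo_comp_add_right
      (fun t => ∫⁻ x, ENNReal.ofReal (frobeniusNormSq (fderiv ℝ (X.u t) x))) 0 (t₁ - t₀) t₀
    simp only [zero_add, sub_add_cancel] at htr
    show ∫⁻ τ in Ioo 0 (t₁ - t₀), ∫⁻ x, ENNReal.ofReal (frobeniusNormSq (fderiv ℝ (X.u (τ + t₀)) x)) ≤ _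
    rw [htr]
    exact (lintegral_mono_set (Ioo_subset_Ioo h0 h1T.le)).trans hdissT
  -- the stretching estimate on the shifted slab
  have hstrS : ∀ t ∈ Icc 0 (t₁ - t₀),
      2 * ∫ x, inner ℝ (curl ((fun τ => X.u (τ + t₀)) t) x)
          (fderiv ℝ ((fun τ => X.u (τ + t₀)) t) x (curl ((fun τ => X.u (τ + t₀)) t) x)) ≤
        ν * (∫ x, frobeniusNormSq (fderiv ℝ (curl ((fun τ => X.u (τ + t₀)) t)) x)) +
          (C₁ + C₂ * (∫ x, ‖curl ((fun τ => X.u (τ + t₀)) t) x‖ ^ 2) +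
              C₃ * (∫ x, ‖(fun τ => X.u (τ + t₀)) t x‖ ^ 2)) *
            (∫ x, ‖curl ((fun τ => X.u (τ + t₀)) t) x‖ ^ 2) +
          C₄ * (∫ x, frobeniusNormSq (fderiv ℝ ((fun τ => X.u (τ + t₀)) t) x)) := by
    intro t ht
    have hv : ContDiff ℝ ∞ (X.u (t + t₀)) := hS.contDiff_velocity ht
    have hv4 : ContDiff ℝ 4 (X.u (t + t₀)) := hv.of_le (by norm_cast)
    have hv2 : ContDiff ℝ 2 (X.u (t + t₀)) := hv.of_le (by norm_cast)
    have hfin : ∀ n, ∫⁻ x, ‖iteratedFDeriv ℝ n (X.u (t + t₀)) x‖ₑ ^ 2 < ⊤ := fun n => by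
      obtain ⟨Cn, hCn⟩ := hB n
      exact (hCn t ht).trans_lt ENNReal.coe_lt_top
    have i0 : Integrable fun x => ‖X.u (t + t₀) x‖ ^ 2 :=
      integrable_sq_norm_of_lintegral_lt_top hv.continuous ((hen' t ht).trans_lt ENNReal.ofReal_lt_top)
    have i1 : Integrable fun x => ‖fderiv ℝ (X.u (t + t₀)) x‖ ^ 2 := by
      have h := integrable_sq_norm_of_lintegral_lt_top (hv4.continuous_iteratedFDeriv (by norm_num))
        (hfin 1)
      exact h.congr (Eventually.of_forall fun x => by simp only [norm_iteratedFDeriv_one])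
    have i2 : Integrable fun x => ‖fderiv ℝ (fderiv ℝ (X.u (t + t₀))) x‖ ^ 2 := by
      have h := integrable_sq_norm_of_lintegral_lt_top (hv4.continuous_iteratedFDeriv (by norm_num))
        (hfin 2)
      refine h.congr (Eventually.of_forall fun x => ?_)
      show ‖iteratedFDeriv ℝ 2 (X.u (t + t₀)) x‖ ^ 2 = ‖fderiv ℝ (fderiv ℝ (X.u (t + t₀))) x‖ ^ 2
      rw [← norm_iteratedFDeriv_fderiv, norm_iteratedFDeriv_one]
    obtain ⟨B₂, -, hB₂⟩ := exists_forall_norm_fderiv_fderiv_le_of_hasBoundedSobolevNormsOn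
      (fun r hr => (hS.contDiff_velocity hr).of_le (by norm_cast)) hB
    exact hstr hv2 (hS.divFree t ht) i0 i1 i2 ⟨B₂, hB₂ t ht⟩
      (hdir (t + t₀) ⟨by linarith [ht.1], by linarith [ht.2]⟩)
  have hY := sq_norm_curl_le_of_direction_slab_forced hν hD hS hB hGs hĒ0 hI0 hen' hdiss'
    hC₁ hC₂ hC₃ hC₄ hstrS (t₁ - t₀) ⟨hD.le, le_rfl⟩
  have hY' : ∫ x, ‖curl (X.u t₁) x‖ ^ 2 ≤
      ((∫ x, ‖curl (X.u t₀) x‖ ^ 2) + C₄ * I + G * (t₁ - t₀)) *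
        Real.exp ((C₁ + C₃ * Ē + 1) * (t₁ - t₀) + C₂ * (‖curlCLM‖ ^ 2 * I)) := by
    have e1 : (fun τ => X.u (τ + t₀)) (t₁ - t₀) = X.u t₁ := by simp only [sub_add_cancel]
    have e0 : (fun τ => X.u (τ + t₀)) 0 = X.u t₀ := by simp only [zero_add]
    simpa only [e1, e0] using hY
  refine hY'.trans ?_
  have hY00 : 0 ≤ ∫ x, ‖curl (X.u t₀) x‖ ^ 2 := integral_nonneg fun x => sq_nonneg _
  have h1 : (G : ℝ) * (t₁ - t₀) ≤ G * X.T := mul_le_mul_of_nonneg_left (by linarith) G.coe_nonneg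
  have h2 : (C₁ + C₃ * Ē + 1) * (t₁ - t₀) ≤ (C₁ + C₃ * Ē + 1) * X.T :=
    mul_le_mul_of_nonneg_left (by linarith) (by positivity)
  rw [hP, hQ]
  exact mul_le_mul (by linarith) (Real.exp_le_exp.2 (by linarith)) (Real.exp_pos _).le
    (by positivity)

/-- **The e-fold reading**: with the `P, Q` of `sq_norm_curl_le_of_coherent_window`, over every window
of direction coherence with `∫|curl u(t₁)|² > 0` and `∫|curl u(t₀)|² > 0`:
`log(∫|ω(t₁)|² / ∫|ω(t₀)|²) ≤ log Q + log(1 + P / ∫|ω(t₀)|²)` — the enstrophy e-folds of a coherent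
window are bounded independently of its length and of what happens inside it.
[cite: ConstantinFeffermanIndiana1993, §2 (the enstrophy bound)] -/
theorem log_enstrophy_ratio_le_of_coherent_window (hν : 0 < ν) {Ω ρ : ℝ} (hΩ : 0 < Ω) (hρ : 0 < ρ) :
    ∃ P Q : ℝ, 0 ≤ P ∧ 0 < Q ∧ ∀ t₀ t₁ : ℝ, 0 ≤ t₀ → t₀ < t₁ → t₁ < X.T →
      (∀ t ∈ Icc t₀ t₁, ∀ x y : EuclideanSpace ℝ (Fin 3),
        Ω < ‖curl (X.u t) x‖ → Ω < ‖curl (X.u t) y‖ →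
          Real.sqrt (1 - inner ℝ (vorticityDirection (curl (X.u t)) x)
            (vorticityDirection (curl (X.u t)) y) ^ 2) ≤ ‖x - y‖ / ρ) →
      0 < ∫ x, ‖curl (X.u t₀) x‖ ^ 2 → 0 < ∫ x, ‖curl (X.u t₁) x‖ ^ 2 →
      Real.log ((∫ x, ‖curl (X.u t₁) x‖ ^ 2) / (∫ x, ‖curl (X.u t₀) x‖ ^ 2)) ≤
        Real.log Q + Real.log (1 + P / (∫ x, ‖curl (X.u t₀) x‖ ^ 2)) := by
  obtain ⟨P, Q, hP0, hQ0, hwin⟩ := X.sq_norm_curl_le_of_coherent_window hν hΩ hρ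
  -- `Q` may be taken positive
  refine ⟨P, max Q 1, hP0, lt_max_of_lt_right one_pos, fun t₀ t₁ h0 h01 h1T hdir hY0 hY1 => ?_⟩
  have h := hwin t₀ t₁ h0 h01 h1T hdir
  set Y₁ : ℝ := ∫ x, ‖curl (X.u t₁) x‖ ^ 2 with hY₁def
  set Y₀ : ℝ := ∫ x, ‖curl (X.u t₀) x‖ ^ 2 with hY₀def
  have hQ' : (Y₀ + P) * Q ≤ (Y₀ + P) * max Q 1 :=
    mul_le_mul_of_nonneg_left (le_max_left _ _) (by positivity)
  have hQ1 : 0 < max Q 1 := lt_max_of_lt_right one_pos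
  have hle : Y₁ ≤ (Y₀ + P) * max Q 1 := h.trans hQ'
  have hid : (Y₀ + P) * max Q 1 = Y₀ * (max Q 1 * (1 + P / Y₀)) := by
    field_simp
  rw [Real.log_div hY1.ne' hY0.ne', sub_le_iff_le_add, ← Real.log_mul hQ1.ne' (by positivity),
    add_comm, ← Real.log_mul hY0.ne' (by positivity)]
  exact Real.log_le_log hY1 (hle.trans_eq hid)

end ClayBlowup

/-! ## The tower reading -/

namespace PalasekTowerClayBridge.Realisation

variable {ν : ℝ} {R : TowerRates} (W : Realisation ν R)

/-- **Coherent readout windows are enstrophy-neutral up to a fixed factor, for every tower realisation**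
(`ν > 0`, `Ω, ρ > 0`; no named fact): there are `P, Q ≥ 0` such that for all `j, k` with `τ_j < τ_k`,
if the design keeps its vorticity directions `ρ`-Lipschitz (in the sine sense) on `{|ω| > Ω}` for
`t ∈ [τ_j, τ_k]`, then `∫|ω(τ_k)|² ≤ (∫|ω(τ_j)|² + P) Q` — whatever levels are grown in between.
[cite: ConstantinFeffermanIndiana1993, §2 (the enstrophy bound)] [cite: Palasek2026ElementaryModel, §4] -/
theorem sq_norm_curl_le_of_coherent_readout_window (hν : 0 < ν) {Ω ρ : ℝ} (hΩ : 0 < Ω) (hρ : 0 < ρ) :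
    ∃ P Q : ℝ, 0 ≤ P ∧ 0 ≤ Q ∧ ∀ j k : ℕ, W.τ j < W.τ k →
      (∀ t ∈ Icc (W.τ j) (W.τ k), ∀ x y : EuclideanSpace ℝ (Fin 3),
        Ω < ‖curl (W.u t) x‖ → Ω < ‖curl (W.u t) y‖ →
          Real.sqrt (1 - inner ℝ (vorticityDirection (curl (W.u t)) x)
            (vorticityDirection (curl (W.u t)) y) ^ 2) ≤ ‖x - y‖ / ρ) →
      ∫ x, ‖curl (W.u (W.τ k)) x‖ ^ 2 ≤ ((∫ x, ‖curl (W.u (W.τ j)) x‖ ^ 2) + P) * Q := by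
  obtain ⟨P, Q, hP0, hQ0, hwin⟩ :=
    W.toDesignedBlowup.toClayBlowup.sq_norm_curl_le_of_coherent_window hν hΩ hρ
  exact ⟨P, Q, hP0, hQ0, fun j k hjk hdir =>
    hwin (W.τ j) (W.τ k) (W.τ_mem j).1 hjk (W.τ_mem k).2 hdir⟩

end PalasekTowerClayBridge.Realisation

end Summit.NavierStokesRegularity.FluidComputer

end
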